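import Summits.ValiantsHypothesis.ValiantsHypothesis.Theses.ShallowShadows
import Literature.Computability.Complexity.LindseyLemma
import Literature.Computability.Complexity.MonotoneMatchingDepth
import Summits.ValiantsHypothesis.ValiantsHypothesis.Theorems.RazWigdersonMatching.Negative.ThresholdAndNonVacuity
import Summits.ValiantsHypothesis.ValiantsHypothesis.Theorems.ShallowShadowsRazWigdersonMatchingStubKwPartition
import Summits.ValiantsHypothesis.ValiantsHypothesis.Theorems.ShallowShadowsRazWigdersonMatchingStubSymmetrise
import Summits.ValiantsHypothesis.ValiantsHypothesis.Theorems.ShallowShadowsRazWigdersonMatchingStubEmbedding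
import Summits.ValiantsHypothesis.ValiantsHypothesis.Theorems.ShallowShadowsRazWigdersonMatchingStubPmInvariant
import Summits.ValiantsHypothesis.ValiantsHypothesis.Theorems.ShallowShadowsRazWigdersonMatchingStubParitySumLB
import Summits.ValiantsHypothesis.ValiantsHypothesis.Theorems.ShallowShadowsRazWigdersonMatchingStubEndgame

/-!
# Line `Sketch` (idea `parity-harmonic`) — crux `RazWigdersonMatching` (item `stmt-ValiantsHypothesis-17127`), route `ShallowShadows`

Crux (FAR SIDE of the shadow transfer of route `route-ValiantsHypothesis-ShallowShadows`):
`Summit.ValiantsHypothesis.ValiantsHypothesis.Theses.ShallowShadows.RazWigdersonMatching` —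
`∃ c > 0, ∃ m₀, ∀ m ≥ m₀, 2 ^ (c·m) ≤ formulaSizeOver monotoneBasis (perfectMatchingFn m)`
(monotone formulas for bipartite perfect matching on `K_{m,m}` have `2^{Ω(m)}` gates;
Raz–Wigderson, J. ACM 39 (1992) Thm. 4.2 + formula balancing, as quoted in CGRSS 2026 §1.2).

## The line (lead prover, rebuilt from the idea card `Ideas/parity-harmonic.md`)

PARITY AGAINST THE EXACT HARMONIC PROFILE. No randomized disjointness, no corruption lemma, no
Rothvoss transport, no protocol type, no balancing. The only analytic input is Lindsey's lemma,
PROVED in the tree (`Literature.Computability.Complexity.lindsey`).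

1. (S1 `stub_kwPartition`, Karchmer–Wigderson, LEAF form, shared verbatim with the other lines) a
   monotone formula with `s` gates computing `f` yields a partition of `f⁻¹(1) × f⁻¹(0)` into
   `L ≤ s + 1` rectangles `A l × B l` labelled by variables `lab l` that are valid monotone KW
   answers there (`x (lab l) = 1`, `y (lab l) = 0`). [KarchmerWigderson1990; Rao–Yehudayoff
   Lemma 9.2; Rychkov / Jukna 2012 §3.3]
2. (S3 `stub_embedding`, static) for `2u + 1 ≤ n`, pairs of `u`-bit vectors `(x, y)` embed into
   the monotone KW game of `PM_n`: Alice's input `eA x` is a permutation matrix (block `i` crossed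
   iff `x i`), Bob's input `eB y` is the complement of a Hall obstruction (`|y| + 1` rows whose
   neighbourhood has `|y|` columns), so `PM (eA x) = 1`, `PM (eB y) = 0`; the KW answers
   `{e : eA x e = 1, eB y e = 0}` are a PLANTED cell `p` plus exactly one cell per `i ∈ x ∩ y`
   (`#answers = |x ∩ y| + 1`), and for every answer `e` some row/column relabelling
   `(α, β) ∈ S_n × S_n` fixes both inputs and maps `p ↦ e` (stabiliser transitivity by explicit
   transposition pairs). [Raz–Wigderson 1992 Thm. 4.2 (vertex duplication); Rao–Yehudayoff
   Thm. 9.5 (planted edge)]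
3. (S6 `stub_pmInvariant`) `perfectMatchingFn n` is invariant under row/column relabellings.
4. (S2 `stub_symmetrise`, the lever, GENERIC) for any relabelling-invariant `f`, any labelled
   rectangle partition of its monotone KW game with `L` parts, and any planted family of instances
   as in 2–3, averaging over `τ ∈ S_n × S_n` the pulled-back answer is UNIFORM on the answers
   (left multiplication by a stabiliser element permutes the fibres), so
   `T(x,y) = P_τ[pulled-back answer = p] = 1/#answers(x,y)` EXACTLY, and unfolding the unique leaf
   writes `T` as a NON-NEGATIVE combination of rectangles `{x : eA x ∘ τ ∈ A l} × {y : eB y ∘ τ ∈ B l}`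
   (weights `1/|S_n|²` on the pairs `(τ, l)` with `τ · lab l = p`) of total weight `≤ L`.
5. (S4 `stub_paritySumLB`) the parity pairing of the harmonic profile:
   `Σ_{x,y} (−1)^{|x∩y|}/(1+|x∩y|) = Σ_k C(u,k) 3^{u−k} (−1)^k/(k+1) = (3^{u+1} − 2^{u+1})/(u+1)
   ≥ 3^u/(u+1)` (`= ∫₀¹ (3 − t)^u dt`).
6. Composition (PROVED below, `RazWigdersonMatching_of`): by 2–4 with `u = ⌊(m−1)/2⌋`,
   `Σ_{x,y} ipSign x y/(1+|x∩y|) = Σ_j w_j Σ_{X_j × Y_j} ipSign ≤ (Σ_j w_j) · 2^u √2^u ≤ L 2^u √2^u`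
   (`lindsey` with indicator weights), so with 5 and `L ≤ s + 1`:
   `3^u/(u+1) ≤ (s + 1) 2^u √2^u`, and since `3 > 2√2` the real-analysis endgame
   (S5 `stub_endgame`) gives `2^{c m} ≤ s` for `m ≥ m₀`; non-vacuity of `formulaSizeOver`
   (`m ≥ 1`) is the landed Negative lemma `exists_monotoneFormula_perfectMatchingFn` (p149969).

Disproof used (`Cruxes/RazWigdersonMatching/Disproof.lean`, refuter-rattack 2026-08-17):
`razWigdersonMatching_false_without_threshold` — honoured, the composition takes
`m ≥ max m₀ 1` with the endgame's `m₀` (the leaf bound is `< 1` for small `u`); non-vacuity (b)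
is imported and used; no refuted/uncertified strengthening (circuit form, `c > 1`) is assumed:
everything is about formula LEAVES (`L ≤ size + 1`) and the constant produced is `c ≈ 0.01`.

All stub signatures are self-contained (Mathlib + Literature names only, no local definitions),
so that each stub can land verbatim as a helper file under `Theorems/`.

References: [RazWigderson1992] Thm. 4.2; [KarchmerWigderson1990]; Rao–Yehudayoff,
*Communication Complexity* (CUP 2020) Lemma 9.2, Thm. 9.5; [Jukna2012] §3.3, §7.6, Appendix A
(Lindsey); Chor–Goldreich 1988 (IP discrepancy); [CavalarEtAl2026] §1.2 (arXiv:2507.16105).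
-/

set_option linter.dupNamespace false

noncomputable section

namespace Summit.ValiantsHypothesis.ValiantsHypothesis.Cruxes.RazWigdersonMatching.ParityHarmonic

open Finset
open Literature.Computability.Complexity
open Literature.Barriers.PneNP (perfectMatchingFn perfectMatchingFn_eq_true_iff)
open Summit.ValiantsHypothesis.ValiantsHypothesis.Theses.ShallowShadows (RazWigdersonMatching)

/-! ## The six stub statements (as `Prop`s) -/

/-- S1 — KARCHMER–WIGDERSON, monotone, LEAF (partition-number) form (shared verbatim with the
registered `stub_kwPartition` of `Lines/rothvoss_planted.lean`): a FORMULA `C` over `{∧₂, ∨₂}`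
with `C.size` gates computing `f` yields at most `C.size + 1` rectangles `A l × B l`, labelled
by variables `lab l`, such that every pair `(x, y) ∈ f⁻¹(1) × f⁻¹(0)` lies in EXACTLY ONE of
them and the label is a valid answer of the monotone KW game there. In the tree's straight-line
model: an additive potential over the unreferenced gates `Circuit.unusedBelow` (after
`MonotoneNechiporuk.lean`), with the measure `ν(h) = min #parts − 1`, `ν(xᵢ) = 0`,
`ν(g ∨ h), ν(g ∧ h) ≤ ν(g) + ν(h) + 1`. [KarchmerWigderson1990; RaoYehudayoff2020 Lemma 9.2;
Jukna2012 §3.3 (Rychkov) — size M–L] -/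
def MonotoneKWPartition : Prop :=
  ∀ (ι : Type) [Fintype ι] [DecidableEq ι] (f : (ι → Bool) → Bool) (C : Circuit ι),
    C.IsOver monotoneBasis → C.IsFormula → C.Computes f →
      ∃ L : ℕ, L ≤ C.size + 1 ∧
        ∃ (A : Fin L → Set (ι → Bool)) (B : Fin L → Set (ι → Bool)) (lab : Fin L → ι),
          (∀ x y, f x = true → f y = false → ∃! l, x ∈ A l ∧ y ∈ B l) ∧
          (∀ l x y, x ∈ A l → y ∈ B l → f x = true → f y = false →
            x (lab l) = true ∧ y (lab l) = false)

/-- S2 — PLANTED SYMMETRISATION (the lever; generic group averaging). For a row/column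
relabelling-invariant `f` on `n × n` Boolean matrices, a labelled rectangle partition of its
monotone KW game with `L` parts, and planted instance families `eA : X → f⁻¹(1)`,
`eB : Y → f⁻¹(0)` with a common answer `p` such that the stabiliser of every instance in
`S_n × S_n` reaches every answer from `p`: the matrix `(x, y) ↦ 1/#answers(eA x, eB y)` is an
EXACT non-negative combination of rectangles of total weight `≤ L`. Proof: for fixed `(x, y)` and
`τ = (α, β)` let `l(τ)` be the unique part containing `(eA x ∘ τ, eB y ∘ τ)` and
`ans τ = τ · lab (l τ)` (an answer of `(x, y)`); for `h` in the stabiliser `ans (h τ) = h · ans τ`,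
so left multiplication by the given `h` with `h · p = e` is a bijection fibre(`p`) → fibre(`e`);
the fibres over the answers partition `S_n × S_n`, hence `#fibre(p) = |S_n|²/#answers`; and
`𝟙[ans τ = p] = Σ_l 𝟙[eA x ∘ τ ∈ A l] 𝟙[eB y ∘ τ ∈ B l] 𝟙[τ · lab l = p]` by uniqueness of the
part. Weights `w (τ, l) = 𝟙[τ · lab l = p]/|S_n|²`, `Σ w ≤ L`. [RaoYehudayoff2020 Thm. 9.5
("equally likely to be one of the k+1 edges"); Jukna2012 §7.6 — size M] -/
def PlantedSymmetrisation : Prop :=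
  ∀ (n L : ℕ) (X Y : Type) [Fintype X] [DecidableEq X] [Fintype Y] [DecidableEq Y]
    (f : (Fin n × Fin n → Bool) → Bool),
    (∀ (α β : Equiv.Perm (Fin n)) (z : Fin n × Fin n → Bool),
        f (fun c => z (α c.1, β c.2)) = f z) →
    ∀ (A B : Fin L → Set (Fin n × Fin n → Bool)) (lab : Fin L → Fin n × Fin n),
    (∀ x y, f x = true → f y = false → ∃! l, x ∈ A l ∧ y ∈ B l) →
    (∀ l x y, x ∈ A l → y ∈ B l → f x = true → f y = false →
        x (lab l) = true ∧ y (lab l) = false) →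
    ∀ (eA : X → (Fin n × Fin n → Bool)) (eB : Y → (Fin n × Fin n → Bool)) (p : Fin n × Fin n),
    (∀ x, f (eA x) = true) → (∀ y, f (eB y) = false) →
    (∀ x y, eA x p = true ∧ eB y p = false) →
    (∀ x y (e : Fin n × Fin n), eA x e = true → eB y e = false →
        ∃ α β : Equiv.Perm (Fin n),
          (∀ c : Fin n × Fin n, eA x (α c.1, β c.2) = eA x c) ∧
          (∀ c : Fin n × Fin n, eB y (α c.1, β c.2) = eB y c) ∧
          (α p.1, β p.2) = e) →
    ∃ (J : ℕ) (w : Fin J → ℝ) (Xs : Fin J → Finset X) (Ys : Fin J → Finset Y),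
      (∀ j, 0 ≤ w j) ∧ (∑ j, w j ≤ (L : ℝ)) ∧
      ∀ (x : X) (y : Y),
        ∑ j, w j * ((if x ∈ Xs j then (1 : ℝ) else 0) * (if y ∈ Ys j then (1 : ℝ) else 0)) =
          1 / ((Finset.univ.filter fun e : Fin n × Fin n =>
                  eA x e = true ∧ eB y e = false).card : ℝ)

/-- S3 — THE STATIC BLOCK EMBEDDING of pairs of `u`-bit vectors into the monotone KW game of
`perfectMatchingFn n`, `2u + 1 ≤ n` (Raz–Wigderson's vertex duplication with Rao–Yehudayoff's
planted edge). One layout that works: rows/columns `a i = i`, `b i = u + i` (`i < u`), planted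
`p = (2u, 2u)`, the rest idle. Alice: `eA x` = the permutation matrix of the involution swapping
`a i ↔ b i` for `x i = 1` and fixing everything else (`PM = 1`). Bob: `eB y` = all cells EXCEPT
`S × W`, `S = {a i : y i} ∪ {2u}` (rows), `W = (Fin n) ∖ {a i : y i}` (columns): the `|y| + 1`
rows `S` see only the `|y|` columns `{a i : y i}`, so `PM = 0` (a perfect matching would inject
`S` into `Wᶜ`). Answers = cells of `eA x` inside `S × W` = `{(a i, b i) : x i ∧ y i} ∪ {(2u, 2u)}`.
Stabiliser transpositions: `α = (a i  2u)` on rows, `β = (b i  2u)` on columns fix both inputs and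
map `p ↦ (a i, b i)`. [RazWigderson1992 Thm. 4.2; RaoYehudayoff2020 Thm. 9.5 — size M] -/
def BlockEmbedding : Prop :=
  ∀ (n u : ℕ), 2 * u + 1 ≤ n →
    ∃ (eA : (Fin u → Bool) → (Fin n × Fin n → Bool))
      (eB : (Fin u → Bool) → (Fin n × Fin n → Bool)) (p : Fin n × Fin n),
      (∀ x, perfectMatchingFn n (eA x) = true) ∧
      (∀ y, perfectMatchingFn n (eB y) = false) ∧
      (∀ x y, eA x p = true ∧ eB y p = false) ∧
      (∀ x y, (Finset.univ.filter fun e : Fin n × Fin n =>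
          eA x e = true ∧ eB y e = false).card =
        (Finset.univ.filter fun i : Fin u => (x i && y i) = true).card + 1) ∧
      (∀ x y (e : Fin n × Fin n), eA x e = true → eB y e = false →
        ∃ α β : Equiv.Perm (Fin n),
          (∀ c : Fin n × Fin n, eA x (α c.1, β c.2) = eA x c) ∧
          (∀ c : Fin n × Fin n, eB y (α c.1, β c.2) = eB y c) ∧
          (α p.1, β p.2) = e)

/-- S6 — `perfectMatchingFn n` is invariant under relabelling rows and columns
(`σ ↦ β⁻¹ σ α` transports perfect matchings). [folklore — size S] -/
def PMInvariant : Prop :=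
  ∀ (n : ℕ) (α β : Equiv.Perm (Fin n)) (z : Fin n × Fin n → Bool),
    perfectMatchingFn n (fun c => z (α c.1, β c.2)) = perfectMatchingFn n z

/-- S4 — THE PARITY PAIRING OF THE HARMONIC PROFILE (lower-bound form):
`3^u/(u+1) ≤ Σ_{x,y ∈ {0,1}^u} (−1)^{|x∩y|}/(|x∩y|+1)`; in fact the sum equals
`Σ_k C(u,k) 3^{u−k} (−1)^k/(k+1) = (3^{u+1} − 2^{u+1})/(u+1) = ∫₀¹ (3 − t)^u dt`
(`1/(k+1) = ∫₀¹ t^k dt` and `Σ_{x,y} t^{|x∩y|} = (3 + t)^u`). [folklore; Jukna2012 Appendix A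
conventions (`ipSign_eq_pow`) — size S–M] -/
def HarmonicParitySumLB : Prop :=
  ∀ u : ℕ, (3 : ℝ) ^ u / ((u : ℝ) + 1) ≤
    ∑ x : Fin u → Bool, ∑ y : Fin u → Bool,
      ipSign x y / (((Finset.univ.filter fun i : Fin u => (x i && y i) = true).card : ℝ) + 1)

/-- S5 — THE REAL-ANALYSIS ENDGAME: since `3 > 2√2`, from `3^u/(u+1) ≤ (s+1) · 2^u · √2^u` with
`u = ⌊(m−1)/2⌋` one gets `s ≥ 2^{c m}` for all large `m` (any `c < (log₂ 3 − 3/2)/2 ≈ 0.042`;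
e.g. `c = 1/100`, `m₀` a few hundred). [folklore — size S–M] -/
def Endgame : Prop :=
  ∃ c : ℝ, 0 < c ∧ ∃ m₀ : ℕ, ∀ m : ℕ, m₀ ≤ m → ∀ s : ℕ,
    (3 : ℝ) ^ ((m - 1) / 2) / ((((m - 1) / 2 : ℕ) : ℝ) + 1) ≤
        ((s : ℝ) + 1) * ((2 : ℝ) ^ ((m - 1) / 2) * Real.sqrt 2 ^ ((m - 1) / 2)) →
      (2 : ℝ) ^ (c * m) ≤ s

/-! ## Registered stubs — ALL LANDED (p167241, p166184, p166816, p166355, p166681, p166569); the composition is landed as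
`Theorems/ShallowShadowsRazWigdersonMatching.lean` (p167538, `razWigdersonMatching_proof`), item closed `proved` 2026-08-17T14:55Z -/

/-- STUB `stub_kwPartition` (signature = `MonotoneKWPartition` verbatim, = the registered stub of
`Lines/rothvoss_planted.lean`): Karchmer–Wigderson simulation of a monotone formula by its leaf
rectangles. [KarchmerWigderson1990; RaoYehudayoff2020 Lemma 9.2 — size M–L] -/
theorem stub_kwPartition :
    ∀ (ι : Type) [Fintype ι] [DecidableEq ι] (f : (ι → Bool) → Bool) (C : Circuit ι),
      C.IsOver monotoneBasis → C.IsFormula → C.Computes f →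
        ∃ L : ℕ, L ≤ C.size + 1 ∧
          ∃ (A : Fin L → Set (ι → Bool)) (B : Fin L → Set (ι → Bool)) (lab : Fin L → ι),
            (∀ x y, f x = true → f y = false → ∃! l, x ∈ A l ∧ y ∈ B l) ∧
            (∀ l x y, x ∈ A l → y ∈ B l → f x = true → f y = false →
              x (lab l) = true ∧ y (lab l) = false) :=
  Summit.ValiantsHypothesis.ValiantsHypothesis.Theorems.ShallowShadowsRazWigdersonMatching.stub_kwPartition

/-- STUB `stub_symmetrise` (signature = `PlantedSymmetrisation` verbatim): the planted
one-run statistic is an exact non-negative rectangle combination of weight `≤ L`.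
[RaoYehudayoff2020 Thm. 9.5 — size M] -/
theorem stub_symmetrise :
    ∀ (n L : ℕ) (X Y : Type) [Fintype X] [DecidableEq X] [Fintype Y] [DecidableEq Y]
      (f : (Fin n × Fin n → Bool) → Bool),
      (∀ (α β : Equiv.Perm (Fin n)) (z : Fin n × Fin n → Bool),
          f (fun c => z (α c.1, β c.2)) = f z) →
      ∀ (A B : Fin L → Set (Fin n × Fin n → Bool)) (lab : Fin L → Fin n × Fin n),
      (∀ x y, f x = true → f y = false → ∃! l, x ∈ A l ∧ y ∈ B l) →
      (∀ l x y, x ∈ A l → y ∈ B l → f x = true → f y = false →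
          x (lab l) = true ∧ y (lab l) = false) →
      ∀ (eA : X → (Fin n × Fin n → Bool)) (eB : Y → (Fin n × Fin n → Bool)) (p : Fin n × Fin n),
      (∀ x, f (eA x) = true) → (∀ y, f (eB y) = false) →
      (∀ x y, eA x p = true ∧ eB y p = false) →
      (∀ x y (e : Fin n × Fin n), eA x e = true → eB y e = false →
          ∃ α β : Equiv.Perm (Fin n),
            (∀ c : Fin n × Fin n, eA x (α c.1, β c.2) = eA x c) ∧
            (∀ c : Fin n × Fin n, eB y (α c.1, β c.2) = eB y c) ∧
            (α p.1, β p.2) = e) →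
      ∃ (J : ℕ) (w : Fin J → ℝ) (Xs : Fin J → Finset X) (Ys : Fin J → Finset Y),
        (∀ j, 0 ≤ w j) ∧ (∑ j, w j ≤ (L : ℝ)) ∧
        ∀ (x : X) (y : Y),
          ∑ j, w j * ((if x ∈ Xs j then (1 : ℝ) else 0) * (if y ∈ Ys j then (1 : ℝ) else 0)) =
            1 / ((Finset.univ.filter fun e : Fin n × Fin n =>
                    eA x e = true ∧ eB y e = false).card : ℝ) :=
  Summit.ValiantsHypothesis.ValiantsHypothesis.Theorems.ShallowShadowsRazWigdersonMatching.stub_symmetrise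

/-- STUB `stub_embedding` (signature = `BlockEmbedding` verbatim): the planted block embedding of
`u`-bit vector pairs into the KW game of `PM_n`, `2u + 1 ≤ n`. [RazWigderson1992 Thm. 4.2;
RaoYehudayoff2020 Thm. 9.5 — size M] -/
theorem stub_embedding :
    ∀ (n u : ℕ), 2 * u + 1 ≤ n →
      ∃ (eA : (Fin u → Bool) → (Fin n × Fin n → Bool))
        (eB : (Fin u → Bool) → (Fin n × Fin n → Bool)) (p : Fin n × Fin n),
        (∀ x, perfectMatchingFn n (eA x) = true) ∧
        (∀ y, perfectMatchingFn n (eB y) = false) ∧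
        (∀ x y, eA x p = true ∧ eB y p = false) ∧
        (∀ x y, (Finset.univ.filter fun e : Fin n × Fin n =>
            eA x e = true ∧ eB y e = false).card =
          (Finset.univ.filter fun i : Fin u => (x i && y i) = true).card + 1) ∧
        (∀ x y (e : Fin n × Fin n), eA x e = true → eB y e = false →
          ∃ α β : Equiv.Perm (Fin n),
            (∀ c : Fin n × Fin n, eA x (α c.1, β c.2) = eA x c) ∧
            (∀ c : Fin n × Fin n, eB y (α c.1, β c.2) = eB y c) ∧
            (α p.1, β p.2) = e) :=
  Summit.ValiantsHypothesis.ValiantsHypothesis.Theorems.ShallowShadowsRazWigdersonMatching.stub_embedding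

/-- STUB `stub_pmInvariant` (signature = `PMInvariant` verbatim): relabelling invariance of
`perfectMatchingFn`. [folklore — size S] -/
theorem stub_pmInvariant :
    ∀ (n : ℕ) (α β : Equiv.Perm (Fin n)) (z : Fin n × Fin n → Bool),
      perfectMatchingFn n (fun c => z (α c.1, β c.2)) = perfectMatchingFn n z :=
  Summit.ValiantsHypothesis.ValiantsHypothesis.Theorems.ShallowShadowsRazWigdersonMatching.stub_pmInvariant

/-- STUB `stub_paritySumLB` (signature = `HarmonicParitySumLB` verbatim): the parity pairing of
the harmonic profile is at least `3^u/(u+1)`. [folklore — size S–M] -/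
theorem stub_paritySumLB :
    ∀ u : ℕ, (3 : ℝ) ^ u / ((u : ℝ) + 1) ≤
      ∑ x : Fin u → Bool, ∑ y : Fin u → Bool,
        ipSign x y / (((Finset.univ.filter fun i : Fin u => (x i && y i) = true).card : ℝ) + 1) :=
  Summit.ValiantsHypothesis.ValiantsHypothesis.Theorems.ShallowShadowsRazWigdersonMatching.stub_paritySumLB

/-- STUB `stub_endgame` (signature = `Endgame` verbatim): `3 > 2√2` turned into `2^{c m} ≤ s`.
[folklore — size S–M] -/
theorem stub_endgame :
    ∃ c : ℝ, 0 < c ∧ ∃ m₀ : ℕ, ∀ m : ℕ, m₀ ≤ m → ∀ s : ℕ,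
      (3 : ℝ) ^ ((m - 1) / 2) / ((((m - 1) / 2 : ℕ) : ℝ) + 1) ≤
          ((s : ℝ) + 1) * ((2 : ℝ) ^ ((m - 1) / 2) * Real.sqrt 2 ^ ((m - 1) / 2)) →
        (2 : ℝ) ^ (c * m) ≤ s :=
  Summit.ValiantsHypothesis.ValiantsHypothesis.Theorems.ShallowShadowsRazWigdersonMatching.stub_endgame

/-! ## Name-keyed aliases -/
namespace Registered
/-- Alias of `MonotoneKWPartition` (= the signature of `stub_kwPartition`). -/
abbrev stub_kwPartition : Prop := MonotoneKWPartition
/-- Alias of `PlantedSymmetrisation` (= the signature of `stub_symmetrise`). -/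
abbrev stub_symmetrise : Prop := PlantedSymmetrisation
/-- Alias of `BlockEmbedding` (= the signature of `stub_embedding`). -/
abbrev stub_embedding : Prop := BlockEmbedding
/-- Alias of `PMInvariant` (= the signature of `stub_pmInvariant`). -/
abbrev stub_pmInvariant : Prop := PMInvariant
/-- Alias of `HarmonicParitySumLB` (= the signature of `stub_paritySumLB`). -/
abbrev stub_paritySumLB : Prop := HarmonicParitySumLB
/-- Alias of `Endgame` (= the signature of `stub_endgame`). -/
abbrev stub_endgame : Prop := Endgame
end Registered

/-! ## Helpers (sorry-free) -/

/-- `Σ_{a,b} W a b · 𝟙[a ∈ X] 𝟙[b ∈ Y] = Σ_{a ∈ X} Σ_{b ∈ Y} W a b` (rectangle sums). -/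
theorem sum_mul_indicator_rect {α β : Type} [Fintype α] [Fintype β] [DecidableEq α]
    [DecidableEq β] (W : α → β → ℝ) (X : Finset α) (Y : Finset β) :
    ∑ a, ∑ b, W a b * ((if a ∈ X then (1 : ℝ) else 0) * (if b ∈ Y then (1 : ℝ) else 0)) =
      ∑ a ∈ X, ∑ b ∈ Y, W a b := by
  have inner : ∀ a, ∑ b, W a b * ((if a ∈ X then (1 : ℝ) else 0) * (if b ∈ Y then (1 : ℝ) else 0))
      = if a ∈ X then ∑ b ∈ Y, W a b else 0 := by
    intro a
    by_cases ha : a ∈ X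
    · simp only [ha, if_true, one_mul]
      have hb : ∀ b, W a b * (if b ∈ Y then (1 : ℝ) else 0) = if b ∈ Y then W a b else 0 :=
        fun b => by split_ifs <;> simp
      rw [Finset.sum_congr rfl (fun b _ => hb b), Finset.sum_ite_mem, Finset.univ_inter]
    · simp [ha]
  rw [Finset.sum_congr rfl (fun a _ => inner a), Finset.sum_ite_mem, Finset.univ_inter]

/-- Lindsey's lemma on a rectangle of `{0,1}^u × {0,1}^u`:
`Σ_{x ∈ X} Σ_{y ∈ Y} (−1)^{|x∩y|} ≤ 2^u √2^u`. -/
theorem rect_sum_ipSign_le (u : ℕ) (X Y : Finset (Fin u → Bool)) :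
    ∑ x ∈ X, ∑ y ∈ Y, ipSign x y ≤ (2 : ℝ) ^ u * Real.sqrt 2 ^ u := by
  classical
  have h := lindsey (n := Fin u) (fun x => if x ∈ X then (1 : ℝ) else 0)
    (fun y => if y ∈ Y then (1 : ℝ) else 0)
    (fun x => by split_ifs <;> simp) (fun y => by split_ifs <;> simp)
  rw [Fintype.card_fin] at h
  have hrew : ∑ x, ∑ y, (if x ∈ X then (1 : ℝ) else 0) * (if y ∈ Y then (1 : ℝ) else 0) * ipSign x y
      = ∑ x ∈ X, ∑ y ∈ Y, ipSign x y := by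
    rw [← sum_mul_indicator_rect (fun x y => ipSign x y) X Y]
    refine Finset.sum_congr rfl fun x _ => Finset.sum_congr rfl fun y _ => ?_
    ring
  rw [hrew] at h
  exact (le_abs_self _).trans h

/-! ## Composition (kernel-checked, sorry-free) -/

/-- **Composition.** The KW leaf partition (S1) of a minimal monotone formula for `PM_m`
(attained: non-vacuity is proved; `s` gates) has `L ≤ s + 1` parts; with `u = ⌊(m−1)/2⌋`, the
block embedding (S3), relabelling invariance (S6) and planted symmetrisation (S2) write the
harmonic profile `1/(1+|x∩y|)` on `{0,1}^u × {0,1}^u` as a non-negative rectangle combination of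
total weight `≤ L`; pairing with the Hadamard sign and Lindsey's lemma (in-tree, proved) gives
`Σ_{x,y} (−1)^{|x∩y|}/(1+|x∩y|) ≤ L · 2^u √2^u`, while (S4) the left side is `≥ 3^u/(u+1)`;
the endgame (S5, `3 > 2√2`) turns `3^u/(u+1) ≤ (s+1) 2^u √2^u` into `2^{c m} ≤ s`. -/
theorem RazWigdersonMatching_of :
    Registered.stub_kwPartition → Registered.stub_symmetrise → Registered.stub_embedding →
      Registered.stub_pmInvariant → Registered.stub_paritySumLB → Registered.stub_endgame →
        RazWigdersonMatching := by
  intro hkw hsym hemb hinv hpar hend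
  obtain ⟨c, hc, m₁, hm₁⟩ := hend
  refine ⟨c, hc, max m₁ 1, ?_⟩
  intro m hm
  have hm1 : 1 ≤ m := le_trans (le_max_right _ _) hm
  have hmm₁ : m₁ ≤ m := le_trans (le_max_left _ _) hm
  -- non-vacuity (proved Negative lemma): the infimum defining `formulaSizeOver` is attained
  have hSne : {s | ∃ C : Circuit (Fin m × Fin m), C.IsOver monotoneBasis ∧ C.IsFormula ∧
      C.Computes (perfectMatchingFn m) ∧ C.size = s}.Nonempty := by
    obtain ⟨F, hF₁, hF₂, hF₃⟩ :=
      Summit.ValiantsHypothesis.ValiantsHypothesis.Theorems.RazWigdersonMatching.Negative.exists_monotoneFormula_perfectMatchingFn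
        m hm1
    exact ⟨F.size, F, hF₁, hF₂, hF₃, rfl⟩
  obtain ⟨F, hFover, hFformula, hFcomp, hFsize⟩ := Nat.sInf_mem hSne
  have hfs : formulaSizeOver monotoneBasis (perfectMatchingFn m) = F.size := by
    unfold formulaSizeOver
    exact hFsize.symm
  -- S1: the KW leaf partition of `F`
  obtain ⟨L, hL, A, B, lab, hpart, hvalid⟩ :=
    hkw (Fin m × Fin m) (perfectMatchingFn m) F hFover hFformula hFcomp
  -- the block size
  set u : ℕ := (m - 1) / 2 with hu
  have hun : 2 * u + 1 ≤ m := by omega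
  -- S3: the planted block embedding
  obtain ⟨eA, eB, p, hA, hB, hp, hcard, htrans⟩ := hemb m u hun
  -- S2 (with S6): the harmonic profile as a rectangle combination of weight `≤ L`
  obtain ⟨J, w, Xs, Ys, hw0, hwsum, hstat⟩ :=
    hsym m L (Fin u → Bool) (Fin u → Bool) (perfectMatchingFn m) (hinv m) A B lab hpart hvalid
      eA eB p hA hB hp htrans
  have hT : ∀ x y : Fin u → Bool,
      ∑ j, w j * ((if x ∈ Xs j then (1 : ℝ) else 0) * (if y ∈ Ys j then (1 : ℝ) else 0)) =
        1 / ((((Finset.univ.filter fun i : Fin u => (x i && y i) = true).card : ℕ) : ℝ) + 1) := by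
    intro x y
    rw [hstat x y, hcard x y]
    push_cast
    rfl
  -- the parity pairing, two ways
  set S : ℝ := ∑ x : Fin u → Bool, ∑ y : Fin u → Bool,
    ipSign x y / (((Finset.univ.filter fun i : Fin u => (x i && y i) = true).card : ℝ) + 1) with hS
  have hupper : S ≤ (L : ℝ) * ((2 : ℝ) ^ u * Real.sqrt 2 ^ u) := by
    have h1 : S = ∑ j, w j * ∑ x ∈ Xs j, ∑ y ∈ Ys j, ipSign x y := by
      have h2 : ∀ x y : Fin u → Bool,
          ipSign x y / (((Finset.univ.filter fun i : Fin u => (x i && y i) = true).card : ℝ) + 1) =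
            ∑ j, w j * (ipSign x y * ((if x ∈ Xs j then (1 : ℝ) else 0) *
              (if y ∈ Ys j then (1 : ℝ) else 0))) := by
        intro x y
        rw [div_eq_mul_one_div, ← hT x y, Finset.mul_sum]
        refine Finset.sum_congr rfl fun j _ => ?_
        ring
      calc S = ∑ x : Fin u → Bool, ∑ y : Fin u → Bool, ∑ j, w j * (ipSign x y *
              ((if x ∈ Xs j then (1 : ℝ) else 0) * (if y ∈ Ys j then (1 : ℝ) else 0))) := by
            rw [hS]
            refine Finset.sum_congr rfl fun x _ => Finset.sum_congr rfl fun y _ => h2 x y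
        _ = ∑ x : Fin u → Bool, ∑ j, ∑ y : Fin u → Bool, w j * (ipSign x y *
              ((if x ∈ Xs j then (1 : ℝ) else 0) * (if y ∈ Ys j then (1 : ℝ) else 0))) := by
            refine Finset.sum_congr rfl fun x _ => ?_
            rw [Finset.sum_comm]
        _ = ∑ j, ∑ x : Fin u → Bool, ∑ y : Fin u → Bool, w j * (ipSign x y *
              ((if x ∈ Xs j then (1 : ℝ) else 0) * (if y ∈ Ys j then (1 : ℝ) else 0))) := by
            rw [Finset.sum_comm]
        _ = ∑ j, w j * ∑ x ∈ Xs j, ∑ y ∈ Ys j, ipSign x y := by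
            refine Finset.sum_congr rfl fun j _ => ?_
            rw [← sum_mul_indicator_rect (fun x y => ipSign x y) (Xs j) (Ys j), Finset.mul_sum]
            refine Finset.sum_congr rfl fun x _ => ?_
            rw [Finset.mul_sum]
    rw [h1]
    calc ∑ j, w j * ∑ x ∈ Xs j, ∑ y ∈ Ys j, ipSign x y
        ≤ ∑ j, w j * ((2 : ℝ) ^ u * Real.sqrt 2 ^ u) :=
          Finset.sum_le_sum fun j _ =>
            mul_le_mul_of_nonneg_left (rect_sum_ipSign_le u (Xs j) (Ys j)) (hw0 j)
      _ = (∑ j, w j) * ((2 : ℝ) ^ u * Real.sqrt 2 ^ u) := by rw [Finset.sum_mul]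
      _ ≤ (L : ℝ) * ((2 : ℝ) ^ u * Real.sqrt 2 ^ u) :=
          mul_le_mul_of_nonneg_right hwsum (by positivity)
  have hlower : (3 : ℝ) ^ u / ((u : ℝ) + 1) ≤ S := hpar u
  -- `L ≤ s + 1`
  have hLr : (L : ℝ) ≤ (F.size : ℝ) + 1 := by exact_mod_cast hL
  have hchain : (3 : ℝ) ^ u / ((u : ℝ) + 1) ≤
      ((F.size : ℝ) + 1) * ((2 : ℝ) ^ u * Real.sqrt 2 ^ u) :=
    hlower.trans (hupper.trans (mul_le_mul_of_nonneg_right hLr (by positivity)))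
  -- the endgame
  rw [hfs]
  exact hm₁ m hmm₁ F.size hchain

/-- Wiring check: the registered stubs feed `RazWigdersonMatching_of` exactly as stated, so the
skeleton is `RazWigdersonMatching` closed modulo the six stubs (sorries enter only through them). -/
example : RazWigdersonMatching :=
  RazWigdersonMatching_of stub_kwPartition stub_symmetrise stub_embedding stub_pmInvariant
    stub_paritySumLB stub_endgame

/-- Wiring check with the `def`s: once the six statements are theorems, the crux follows. -/
example (h₁ : MonotoneKWPartition) (h₂ : PlantedSymmetrisation) (h₃ : BlockEmbedding)
    (h₄ : PMInvariant) (h₅ : HarmonicParitySumLB) (h₆ : Endgame) : RazWigdersonMatching :=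
  RazWigdersonMatching_of h₁ h₂ h₃ h₄ h₅ h₆

end Summit.ValiantsHypothesis.ValiantsHypothesis.Cruxes.RazWigdersonMatching.ParityHarmonic

end
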